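import Literature.MathematicalPhysics.KineticTheory.HardSphereEuler
import Literature.Analysis.FluidPDE.HardSphereDynamicsProofs

/-!
# Macroscopic bookkeeping for the hydrodynamic-limit assembly — II: distinct velocities along the flow

Helper file for item stmt-AtomisticToContinuum-11094 (`StiffCollisionalRelaxation.Assembly`).
The comparison field fed into `RelEntropyStability` must take values in the chamber with the
STRICT Cauchy–Schwarz inequality `‖m̄‖² < 2 ρ̄ Ē` at every time `s ≤ t₁` and every block centre;
equality holds exactly when all particles of a block share one velocity. This file supplies the
almost-sure half of that obligation:

* `volume_velCoincide` — the set of configurations in which two distinct particles have the same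
  velocity is Lebesgue-null (a section argument over the particle `i`, `Fin.insertNth` splitting
  of the configuration space, and `volume {v} = 0` in `ℝ³`);
* `ae_liouville_forall_vel_ne` — for every hard-sphere flow, Liouville-almost every initial datum
  has pairwise distinct velocities at ALL times: along a good orbit the velocities are
  right-continuous step functions with locally finitely many jumps (`IsHardSphereTrajectory.free`,
  `locFinite`), so a coincidence at a real time `s` persists up to a rational time `q > s`, and
  the countable union over `q` of the preimages under the measure-preserving maps `Φ_q` of the
  null coincidence set is null;
* `ae_localGibbsLaw_forall_vel_ne` — the same under every local Gibbs law (absolutely continuous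
  with respect to the Liouville measure);
* `integral_kinetic_flow_eq`, `ae_localGibbsLaw_kinetic_and_flow_zero` — conservation of the
  kinetic energy of the empirical measure along good orbits (and `Φ_0 = id`), almost surely under
  the local Gibbs law: the velocity-moment budget of the commutator estimates at positive times.
-/

namespace Summit.AtomisticToContinuum.HydrodynamicLimit.Theorems.MacroBookkeeping

open MeasureTheory Filter Topology Set
open Literature.MathematicalPhysics.KineticTheory
open Literature.Analysis.FluidPDE (Config HardSphereFlow liouville collisionTimes freeFlight)

noncomputable section

variable {N : ℕ}

/-! ### The velocity-coincidence set is Lebesgue-null -/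

/-- Configurations in which particles `i` and `j` have the same velocity. -/
def velCoincide (N : ℕ) (i j : Fin N) : Set (Config N (Fin 3) T3) :=
  {z | (z i).2 = (z j).2}

/-- Membership in `velCoincide`. -/
theorem mem_velCoincide {i j : Fin N} {z : Config N (Fin 3) T3} :
    z ∈ velCoincide N i j ↔ (z i).2 = (z j).2 :=
  Iff.rfl

/-- The coincidence set is measurable. -/
theorem measurableSet_velCoincide (i j : Fin N) : MeasurableSet (velCoincide N i j) :=
  measurableSet_eq_fun (measurable_pi_apply i).snd (measurable_pi_apply j).snd

/-- The one-particle phase space `𝕋³ × ℝ³` carries a σ-finite Lebesgue measure. -/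
theorem sigmaFinite_volume_phase : SigmaFinite (volume : Measure (T3 × V3)) := inferInstance

/-- Configuration space `(𝕋³ × ℝ³)^n` carries a σ-finite Lebesgue measure (the `Π`-instance of
Mathlib is not found by instance search on a non-dependent function type). -/
theorem sigmaFinite_volume_config (n : ℕ) : SigmaFinite (volume : Measure (Fin n → T3 × V3)) := by
  haveI : ∀ _i : Fin n, SigmaFinite (volume : Measure (T3 × V3)) := fun _ => sigmaFinite_volume_phase
  rw [volume_pi]
  infer_instance

/-- **The coincidence set of two distinct particles is Lebesgue-null.** -/
theorem volume_velCoincide {i j : Fin N} (hij : i ≠ j) : volume (velCoincide N i j) = 0 := by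
  obtain ⟨n, rfl⟩ : ∃ n, N = n + 1 := ⟨N - 1, (Nat.succ_pred_eq_of_pos (Fin.pos i)).symm⟩
  obtain ⟨j', hj'⟩ := Fin.exists_succAbove_eq hij.symm
  set e := MeasurableEquiv.piFinSuccAbove (fun _ : Fin (n + 1) => T3 × V3) i with he
  have hmp : MeasurePreserving e volume volume :=
    @volume_preserving_piFinSuccAbove n (fun _ => T3 × V3) _ (fun _ => sigmaFinite_volume_phase) i
  set S : Set ((T3 × V3) × (Fin n → T3 × V3)) := {p | p.1.2 = (p.2 j').2} with hSdef
  have hmeas : MeasurableSet S :=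
    measurableSet_eq_fun measurable_fst.snd ((measurable_pi_apply j').comp measurable_snd).snd
  have hS : velCoincide (n + 1) i j = e ⁻¹' S := by
    ext z
    simp only [velCoincide, mem_setOf_eq, mem_preimage, hSdef, he,
      MeasurableEquiv.piFinSuccAbove_apply, Fin.insertNthEquiv_symm_apply, Fin.removeNth, hj']
  haveI := sigmaFinite_volume_config n
  rw [hS, hmp.measure_preimage hmeas.nullMeasurableSet, Measure.volume_eq_prod,
    Measure.prod_apply_symm hmeas]
  have hsec : ∀ y : Fin n → T3 × V3,
      (volume : Measure (T3 × V3)) ((fun x => (x, y)) ⁻¹' S) = 0 := by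
    intro y
    have h : (fun x : T3 × V3 => (x, y)) ⁻¹' S = (univ : Set T3) ×ˢ {(y j').2} := by
      ext x
      simp [hSdef]
    rw [h, Measure.volume_eq_prod, Measure.prod_prod, measure_singleton, mul_zero]
  simp [hsec]

/-! ### Distinct velocities at all times, almost surely -/

/-- Along a hard-sphere trajectory, after every time `s` there is a rational time `q > s` with no
collision in `(s, q]` (collision times are locally finite). -/
theorem exists_rat_noCollision {ε : ℝ} {γ : ℝ → Config N (Fin 3) T3}
    (hγ : Literature.Analysis.FluidPDE.IsHardSphereTrajectory
      (Literature.Analysis.FluidPDE.Torus.geometry (Fin 3)) ε N γ) (s : ℝ) :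
    ∃ q : ℚ, s < q ∧ ∀ τ ∈ Ioc s (q : ℝ), τ ∉ collisionTimes
      (Literature.Analysis.FluidPDE.Torus.geometry (Fin 3)) ε γ := by
  have hF := hγ.locFinite s (s + 1)
  set F' : Finset ℝ := hF.toFinset.filter (fun τ => s < τ) with hF'
  set B : Finset ℝ := insert (s + 1) F' with hB
  have hBne : B.Nonempty := ⟨s + 1, Finset.mem_insert_self _ _⟩
  set b := B.min' hBne with hb
  have hsb : s < b := by
    refine (Finset.lt_min'_iff B hBne).2 fun τ hτ => ?_
    rcases Finset.mem_insert.1 hτ with rfl | hτ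
    · linarith
    · exact (Finset.mem_filter.1 hτ).2
  obtain ⟨q, hsq, hqb⟩ := exists_rat_btwn hsb
  refine ⟨q, hsq, fun τ hτ hcoll => ?_⟩
  have hτb : τ < b := hτ.2.trans_lt hqb
  have hbs1 : b ≤ s + 1 := Finset.min'_le _ _ (Finset.mem_insert_self _ _)
  have hτF' : τ ∈ F' := by
    refine Finset.mem_filter.2 ⟨hF.mem_toFinset.2 ⟨hcoll, hτ.1.le, ?_⟩, hτ.1⟩
    linarith
  have hbτ : b ≤ τ := Finset.min'_le _ _ (Finset.mem_insert_of_mem hτF')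
  linarith

/-- **Distinct velocities at all times, Liouville-a.e.** For every hard-sphere flow of `N` spheres
on `𝕋³`, for Liouville-almost every initial datum, at every time `s` the velocities of distinct
particles are distinct. -/
theorem ae_liouville_forall_vel_ne {ε : ℝ}
    (Φ : HardSphereFlow (Literature.Analysis.FluidPDE.Torus.geometry (Fin 3)) ε N) :
    ∀ᵐ z ∂liouville (Literature.Analysis.FluidPDE.Torus.geometry (Fin 3)) N ε,
      ∀ s : ℝ, ∀ i j : Fin N, i ≠ j → (Φ.flow s z i).2 ≠ (Φ.flow s z j).2 := by
  set L := liouville (Literature.Analysis.FluidPDE.Torus.geometry (Fin 3)) N ε with hL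
  have hnull : ∀ (q : ℚ) (i j : Fin N), i ≠ j → L ((Φ.flow (q : ℝ)) ⁻¹' velCoincide N i j) = 0 := by
    intro q i j hij
    rw [(Φ.measurePreserving q).measure_preimage (measurableSet_velCoincide i j).nullMeasurableSet]
    have hle : L (velCoincide N i j) ≤ volume (velCoincide N i j) := by
      rw [hL, Literature.Analysis.FluidPDE.liouville_eq]
      exact Measure.le_iff'.1 Measure.restrict_le_self _
    exact le_zero_iff.1 (hle.trans_eq (volume_velCoincide hij))
  have hae : ∀ᵐ z ∂L, ∀ (q : ℚ) (i j : Fin N), i ≠ j → z ∉ (Φ.flow (q : ℝ)) ⁻¹' velCoincide N i j := by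
    rw [ae_all_iff]; intro q
    rw [ae_all_iff]; intro i
    rw [ae_all_iff]; intro j
    by_cases hij : i = j
    · exact Eventually.of_forall fun z hne => (hne hij).elim
    · filter_upwards [measure_eq_zero_iff_ae_notMem.1 (hnull q i j hij)] with z hz _ using hz
  filter_upwards [Φ.ae_mem_good, hae] with z hgood hz s i j hij heq
  have htraj := Φ.isTrajectory z hgood
  obtain ⟨q, hsq, hfree⟩ := exists_rat_noCollision htraj s
  have hflight : Φ.flow (q : ℝ) z =
      freeFlight (Literature.Analysis.FluidPDE.Torus.geometry (Fin 3)) ((q : ℝ) - s) (Φ.flow s z) :=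
    htraj.free s q hsq.le hfree
  have hv : ∀ k, (Φ.flow (q : ℝ) z k).2 = (Φ.flow s z k).2 := fun k => by
    rw [hflight, Literature.Analysis.FluidPDE.freeFlight_apply]
  exact hz q i j hij (by rw [mem_preimage, mem_velCoincide, hv, hv, heq])

/-- The same under any law absolutely continuous with respect to the Liouville measure. -/
theorem ae_forall_vel_ne_of_absolutelyContinuous {ε : ℝ}
    (Φ : HardSphereFlow (Literature.Analysis.FluidPDE.Torus.geometry (Fin 3)) ε N)
    {P : Measure (Config N (Fin 3) T3)}
    (hP : P ≪ liouville (Literature.Analysis.FluidPDE.Torus.geometry (Fin 3)) N ε) :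
    ∀ᵐ z ∂P, ∀ s : ℝ, ∀ i j : Fin N, i ≠ j → (Φ.flow s z i).2 ≠ (Φ.flow s z j).2 :=
  hP.ae_le (ae_liouville_forall_vel_ne Φ)

/-- **Distinct velocities at all times under the local Gibbs law.** For every reduced diameter
`σ`, profiles `(a₀, u₀, θ₀)`, `N` and hard-sphere flow `Φ` of `N + 1` spheres, for
`localGibbsLaw σ a₀ u₀ θ₀ N Φ`-almost every initial datum the velocities of distinct particles are
distinct at every time (the local Gibbs law has a density with respect to the Liouville measure).
In particular no mesoscopic block containing at least two particles is ever exactly cold. -/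
theorem ae_localGibbsLaw_forall_vel_ne (σ : ℝ) (a₀ θ₀ : T3 → ℝ) (u₀ : T3 → V3) (N : ℕ)
    (Φ : HardSphereFlow (Literature.Analysis.FluidPDE.Torus.geometry (Fin 3)) (hsDiameter σ N)
      (N + 1)) :
    ∀ᵐ z ∂localGibbsLaw σ a₀ u₀ θ₀ N Φ,
      ∀ s : ℝ, ∀ i j : Fin (N + 1), i ≠ j → (Φ.flow s z i).2 ≠ (Φ.flow s z j).2 := by
  refine ae_forall_vel_ne_of_absolutelyContinuous Φ ?_
  rw [localGibbsLaw, Literature.Analysis.FluidPDE.particleLaw_eq]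
  exact withDensity_absolutelyContinuous _ _

/-! ### Conservation of the kinetic energy of the empirical measure -/

/-- The kinetic energy of the empirical measure is `N⁻¹` times the configuration energy. -/
theorem integral_kinetic_eq_configEnergy (z : Config N (Fin 3) T3) :
    ∫ y, ‖y.2‖ ^ 2 / 2 ∂Literature.Analysis.FluidPDE.empiricalMeasure z =
      (N : ℝ)⁻¹ * Literature.Analysis.FluidPDE.configEnergy z := by
  rw [Literature.Analysis.FluidPDE.integral_empiricalMeasure, Literature.Analysis.FluidPDE.configEnergy,
    Finset.mul_sum, Finset.mul_sum, Finset.mul_sum]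
  exact Finset.sum_congr rfl fun i _ => by ring

/-- **Energy conservation along good orbits**, empirical-measure form: for `z` in the good set of
a hard-sphere flow, the kinetic energy of the empirical measure of `Φ_t z` does not depend on `t`
(`IsHardSphereTrajectory.configEnergy_eq_holds` + `flow_zero`). -/
theorem integral_kinetic_flow_eq {ε : ℝ}
    (Φ : HardSphereFlow (Literature.Analysis.FluidPDE.Torus.geometry (Fin 3)) ε N)
    {z : Config N (Fin 3) T3} (hz : z ∈ Φ.good) (t : ℝ) :
    ∫ y, ‖y.2‖ ^ 2 / 2 ∂Literature.Analysis.FluidPDE.empiricalMeasure (Φ.flow t z) =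
      ∫ y, ‖y.2‖ ^ 2 / 2 ∂Literature.Analysis.FluidPDE.empiricalMeasure z := by
  rw [integral_kinetic_eq_configEnergy, integral_kinetic_eq_configEnergy,
    Literature.Analysis.FluidPDE.IsHardSphereTrajectory.configEnergy_eq_holds (Φ.isTrajectory z hz)
      t 0]
  simp only [Φ.flow_zero z hz]

/-- The same, Liouville-almost everywhere and for all times simultaneously. -/
theorem ae_liouville_integral_kinetic_flow_eq {ε : ℝ}
    (Φ : HardSphereFlow (Literature.Analysis.FluidPDE.Torus.geometry (Fin 3)) ε N) :
    ∀ᵐ z ∂liouville (Literature.Analysis.FluidPDE.Torus.geometry (Fin 3)) N ε, ∀ t : ℝ,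
      ∫ y, ‖y.2‖ ^ 2 / 2 ∂Literature.Analysis.FluidPDE.empiricalMeasure (Φ.flow t z) =
        ∫ y, ‖y.2‖ ^ 2 / 2 ∂Literature.Analysis.FluidPDE.empiricalMeasure z := by
  filter_upwards [Φ.ae_mem_good] with z hz t using integral_kinetic_flow_eq Φ hz t

/-- **Energy conservation under the local Gibbs law**: almost surely, the kinetic energy of the
empirical measure is conserved along the flow, and `Φ_0 z = z`. -/
theorem ae_localGibbsLaw_kinetic_and_flow_zero (σ : ℝ) (a₀ θ₀ : T3 → ℝ) (u₀ : T3 → V3) (N : ℕ)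
    (Φ : HardSphereFlow (Literature.Analysis.FluidPDE.Torus.geometry (Fin 3)) (hsDiameter σ N)
      (N + 1)) :
    ∀ᵐ z ∂localGibbsLaw σ a₀ u₀ θ₀ N Φ, Φ.flow 0 z = z ∧ ∀ t : ℝ,
      ∫ y, ‖y.2‖ ^ 2 / 2 ∂Literature.Analysis.FluidPDE.empiricalMeasure (Φ.flow t z) =
        ∫ y, ‖y.2‖ ^ 2 / 2 ∂Literature.Analysis.FluidPDE.empiricalMeasure z := by
  have hac : localGibbsLaw σ a₀ u₀ θ₀ N Φ ≪
      liouville (Literature.Analysis.FluidPDE.Torus.geometry (Fin 3)) (N + 1) (hsDiameter σ N) := by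
    rw [localGibbsLaw, Literature.Analysis.FluidPDE.particleLaw_eq]
    exact withDensity_absolutelyContinuous _ _
  refine hac.ae_le ?_
  filter_upwards [Φ.ae_mem_good] with z hz
  exact ⟨Φ.flow_zero z hz, fun t => integral_kinetic_flow_eq Φ hz t⟩

end

end Summit.AtomisticToContinuum.HydrodynamicLimit.Theorems.MacroBookkeeping
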